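import Mathlib
import HarnessLib
import Summits.ValiantsHypothesis.ValiantsHypothesis.Theses.MonotoneRestoration
import Summits.ValiantsHypothesis.ValiantsHypothesis.Theorems.MonotoneRestorationMonotoneRestorationQPEpsilonComplex
import Summits.ValiantsHypothesis.ValiantsHypothesis.Theorems.MonotoneRestorationQP.Negative.LoadBearing
import Literature.Computability.AlgebraicComplexity.DawarWilsenach2025
import Literature.Computability.AlgebraicComplexity.DawarWilsenach2025Thm71
import Literature.Computability.AlgebraicComplexity.SymmetricArithCircuit
import Literature.Computability.AlgebraicComplexity.SymmetricArithCircuitNaive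
import Literature.Computability.AlgebraicComplexity.SymmetricCircuitPairing
import Literature.Computability.AlgebraicComplexity.SymmetricCircuitLinCombSymmetry
import Literature.Computability.AlgebraicComplexity.SymmetricDetCircuitEval
import Literature.Computability.AlgebraicComplexity.TrivialAction
import Literature.Computability.AlgebraicComplexity.ArithCircuit
import Summits.ValiantsHypothesis.ValiantsHypothesis.Theorems.MonotoneRestorationMonotoneRestorationQPSymmetricForwardGradient
import Summits.ValiantsHypothesis.ValiantsHypothesis.Theorems.MonotoneRestorationMonotoneRestorationQPSymmetricConstOutputs
import Summits.ValiantsHypothesis.ValiantsHypothesis.Theorems.MonotoneRestorationMonotoneRestorationQPSymmetricPullbackOutputs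
import Summits.ValiantsHypothesis.ValiantsHypothesis.Theorems.MonotoneRestorationMonotoneRestorationQPSymmetricFibreFold
import Summits.ValiantsHypothesis.ValiantsHypothesis.Theorems.MonotoneRestorationQP.Negative.OrbitCompressionFalseWithoutVP
import Summits.ValiantsHypothesis.ValiantsHypothesis.Theorems.MonotoneRestorationMonotoneRestorationQPZetaMatrix
import Summits.ValiantsHypothesis.ValiantsHypothesis.Theorems.MonotoneRestorationMonotoneRestorationQPLabelledOfArithCircuit
import Summits.ValiantsHypothesis.ValiantsHypothesis.Theorems.MonotoneRestorationMonotoneRestorationQPPderivDetPoly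
import Summits.ValiantsHypothesis.ValiantsHypothesis.Theorems.MonotoneRestorationMonotoneRestorationQPZetaAdjugate
import Summits.ValiantsHypothesis.ValiantsHypothesis.Theorems.MonotoneRestorationMonotoneRestorationQPZetaPatterns
import Summits.ValiantsHypothesis.ValiantsHypothesis.Theorems.MonotoneRestorationMonotoneRestorationQPZetaGenerators
import Summits.ValiantsHypothesis.ValiantsHypothesis.Theorems.MonotoneRestorationMonotoneRestorationQPCoeffMemAdjoinConstants
import Summits.ValiantsHypothesis.ValiantsHypothesis.Theorems.MonotoneRestorationMonotoneRestorationQPCardLeOfAlgebraicIndependentAdjoin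
import Summits.ValiantsHypothesis.ValiantsHypothesis.Theorems.MonotoneRestorationMonotoneRestorationQPCoordsMemOfCoeffsMem
import Summits.ValiantsHypothesis.ValiantsHypothesis.Theorems.MonotoneRestorationMonotoneRestorationQPExistsAlgebraicIndependentComplex
import Summits.ValiantsHypothesis.ValiantsHypothesis.Theorems.MonotoneRestorationMonotoneRestorationQPSymmetricSubstitution
import Summits.ValiantsHypothesis.ValiantsHypothesis.Theorems.MonotoneRestorationMonotoneRestorationQPSymmetricScaledInputs
import Summits.ValiantsHypothesis.ValiantsHypothesis.Theorems.MonotoneRestorationMonotoneRestorationQPSymmetricFoldOutputs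
import Summits.ValiantsHypothesis.ValiantsHypothesis.Theorems.MonotoneRestorationMonotoneRestorationQPSymmetricHadamardOutputs
import Summits.ValiantsHypothesis.ValiantsHypothesis.Theorems.MonotoneRestorationMonotoneRestorationQPSymmetricLinCombOutputs
import Summits.ValiantsHypothesis.ValiantsHypothesis.Theorems.MonotoneRestorationMonotoneRestorationQPHomogeneousComponentVandermonde
import Summits.ValiantsHypothesis.ValiantsHypothesis.Theorems.MonotoneRestorationMonotoneRestorationQPZetaHomogeneous

/-!
# Skeleton — crux `MonotoneRestorationQP`, line `Sketch` v10 (continuation lead c5: the ORBIT CUT)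

Crux item `stmt-ValiantsHypothesis-15886`
(`Summit.ValiantsHypothesis.ValiantsHypothesis.Theses.MonotoneRestoration.MonotoneRestorationQP`).

## History (v1–v9, leads c0–c4; every side stub LANDED, see the tree copy `Lines/Sketch.lean` in git
history and `Cruxes/MonotoneRestorationQP/NOTES.md`)
S1 coset counting (p129725) · S3 coset-block support symmetrisation (p131055) · S4 DW lower-bound
pipeline (p129921) · THEOREM β bi-multilinear slice (p139788) · crux ⇒ Fooling (p140628) · THEOREM γ
cancellation-free restoration FALSE (p144124) · THEOREM δ commuting row scans (p150649) · THEOREM δ′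
exchangeable row scans (p155411) · THEOREM ε signs/monotonicity free, crux ⟺ complex matrix-symmetric
restoration at qp SIZE (p155221, p155888) · sparse / polylog-degree regime (p137433).
The single open stub of v9, S5 = `stub_monotoneSupportReduction` (C⁺: polylog-width supported
programs), is RETIRED in v10: five leads found it crux-sized (C⁺ ⟺ crux modulo S3, necessity
informal), and the planner-of-record registered the certified cut below (stub-add, 2026-08-17T11:55Z).

## v10 = the orbit cut (strategist gen 1, `Lines/orbit_compression.lean`, adopted as the official line)
* `stub_orbitRestoration` (L1): every matrix-symmetric `VP` family over `ℂ` has square-symmetric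
  circuits of quasi-polynomial ORBIT size. Conjecture-grade; ALONE decides the summit
  (`orbitRestoration_decides`, proved); the typed refutation target.
* `stub_orbitCompression` (L2): qp orbits + `VP` ⇒ qp SIZE. Conjecture-grade, VH-free.
* `monotoneRestorationQP_of : MonotoneRestorationQP` — THEOREM ε ∘ L2 ∘ L1 (proved modulo L1, L2);
  `crux_implies_orbitRestoration`, `crux_implies_orbitCompression` (proved): the cut is exact.

## Side stubs Z1–Z7 (lead c5, cycle 1): THEOREM ζ — the SIZE CALCULUS of square-symmetric circuits
Not used by `monotoneRestorationQP_of`; registered so that they land `--supports` (Literature-grade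
constructions over Dawar–Wilsenach circuits, universe-0 instances here). Together with the tree's
pairing (`exists_pairing`), linear combinations (`exists_linComb`), Le Verrier (`leVerrierCircuit`)
and the naive matrix product they make the conclusion class of the crux ("square-symmetric size
`≤ s`") closed under: substitution of an equivariantly computed family into a symmetric circuit (Z1,
the hub), scaling of the inputs (Z2), sums/products over an output family (Z3), Hadamard products and
linear combinations of two equivariant output families (Z4, Z5), homogeneous components (Z6 = the
Vandermonde extraction identity; circuit form composed by the lead from Z1+Z2+Z6), and gradients
(Z7, forward mode). Consequences composed by the lead (cycle 2): products of equivariant matrix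
circuits, determinants / characteristic coefficients of equivariant matrix circuits (Z1 + Le Verrier),
i.e. EQUIVARIANT MATRIX CALCULUS RESTORES WITH POLYNOMIAL SYMMETRIC SIZE — the census exclusion
"coherent-algebra constructions never refute the crux" (c3 memo-6 §2, c4 memo-7 §2.2/§2.5) as a theorem.
-/

set_option linter.dupNamespace false

namespace Summit.ValiantsHypothesis.ValiantsHypothesis.Theorems

open Summit.ValiantsHypothesis.ValiantsHypothesis.Theses.MonotoneRestoration
open Literature.Computability.AlgebraicComplexity
open Filter

/-! ### The two stubs of the orbit cut -/

/-- **L1 — ORBIT-FORM RESTORATION (the finite-model-theory half of the crux).** Every family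
`f_n ∈ ℂ[x_ij]` invariant under independent row and column permutations that is a `VP` family (tree
`IsVPFamily`) has, for every `n`, a square-symmetric labelled circuit over `ℂ` computing `f_n` whose
ORBIT SIZE (largest gate orbit under `Sym(Fin n)`, tree `orbitSize`) is `≤ 2^((log₂ n + c)^c)`; the
number of gates is not bounded.  Strictly weaker than the crux (`orbitSize ≤ size`); necessary for it;
refuted by exactly the same witnesses (a matrix-symmetric `VP` family of counting width `ω(polylog n)`).
[conjecture-grade; cite: DawarWilsenach2025 Thm 6.4/7.1, DwivediPagoSeppelt2026 Outlook Q3] -/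
theorem stub_orbitRestoration :
    ∀ f : (n : ℕ) → MvPolynomial (Fin n × Fin n) ℂ,
      (∀ (n : ℕ) (σ τ : Equiv.Perm (Fin n)),
        MvPolynomial.rename (fun p : Fin n × Fin n => (σ p.1, τ p.2)) (f n) = f n) →
      IsVPFamily f →
      ∃ c : ℕ, ∀ n : ℕ, ∃ (G : Type) (_ : Fintype G)
        (C : LabelledArithCircuit ℂ (Fin n × Fin n) Unit G),
        C.IsSymmetric (Equiv.Perm (Fin n)) ∧ C.eval (C.output ()) = f n ∧
          C.orbitSize (Equiv.Perm (Fin n)) ≤ 2 ^ ((Nat.log 2 n + c) ^ c) := by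
  sorry

/-- **L2 — ORBIT-TO-SIZE COMPRESSION (the circuit half of the crux).** A matrix-symmetric `VP` family
over `ℂ` that admits square-symmetric circuits with quasi-polynomial ORBIT size admits square-symmetric
circuits of quasi-polynomial SIZE.  Strictly weaker than the crux (extra hypothesis); the `VP`
hypothesis is load-bearing (a generic element of the span of exponentially many tree-hom polynomials has
polynomial orbits and exponential circuit size); no lower-bound technique in the tree can refute it
(every instrument bounds orbits).  [conjecture-grade; cite: DawarWilsenach2025 §3.3, §6;
DawarPagoSeppelt2025 §5] -/
theorem stub_orbitCompression :
    ∀ f : (n : ℕ) → MvPolynomial (Fin n × Fin n) ℂ,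
      (∀ (n : ℕ) (σ τ : Equiv.Perm (Fin n)),
        MvPolynomial.rename (fun p : Fin n × Fin n => (σ p.1, τ p.2)) (f n) = f n) →
      IsVPFamily f →
      (∃ c : ℕ, ∀ n : ℕ, ∃ (G : Type) (_ : Fintype G)
        (C : LabelledArithCircuit ℂ (Fin n × Fin n) Unit G),
        C.IsSymmetric (Equiv.Perm (Fin n)) ∧ C.eval (C.output ()) = f n ∧
          C.orbitSize (Equiv.Perm (Fin n)) ≤ 2 ^ ((Nat.log 2 n + c) ^ c)) →
      ∃ c : ℕ, ∀ n : ℕ, ∃ (G : Type) (_ : Fintype G)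
        (C : LabelledArithCircuit ℂ (Fin n × Fin n) Unit G),
        C.IsSymmetric (Equiv.Perm (Fin n)) ∧ C.eval (C.output ()) = f n ∧
          Fintype.card G ≤ 2 ^ ((Nat.log 2 n + c) ^ c) := by
  sorry

/-! ### Composition and certified remarks -/

/-- **Composition.** `MonotoneRestorationQP` from L1 and L2: THEOREM ε (complex form,
`monotoneRestorationQP_iff_complexRestorationQP`, p155888) turns the crux into complex matrix-symmetric
restoration at quasi-polynomial SIZE, which is L2 fed by L1. [folklore] -/
theorem monotoneRestorationQP_of : MonotoneRestorationQP :=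
  monotoneRestorationQP_iff_complexRestorationQP.mpr fun f hs hVP =>
    stub_orbitCompression f hs hVP (stub_orbitRestoration f hs hVP)

/-- crux ⇒ L1 (an orbit is a set of gates: `orbitSize ≤ size = card`). [folklore] -/
theorem crux_implies_orbitRestoration (h : MonotoneRestorationQP) :
    ∀ f : (n : ℕ) → MvPolynomial (Fin n × Fin n) ℂ,
      (∀ (n : ℕ) (σ τ : Equiv.Perm (Fin n)),
        MvPolynomial.rename (fun p : Fin n × Fin n => (σ p.1, τ p.2)) (f n) = f n) →
      IsVPFamily f →
      ∃ c : ℕ, ∀ n : ℕ, ∃ (G : Type) (_ : Fintype G)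
        (C : LabelledArithCircuit ℂ (Fin n × Fin n) Unit G),
        C.IsSymmetric (Equiv.Perm (Fin n)) ∧ C.eval (C.output ()) = f n ∧
          C.orbitSize (Equiv.Perm (Fin n)) ≤ 2 ^ ((Nat.log 2 n + c) ^ c) := by
  intro f hs hVP
  obtain ⟨c, hc⟩ := monotoneRestorationQP_iff_complexRestorationQP.mp h f hs hVP
  refine ⟨c, fun n => ?_⟩
  obtain ⟨G, inst, C, hsym, hev, hcard⟩ := hc n
  exact ⟨G, inst, C, hsym, hev, le_trans (C.orbitSize_le_size (Equiv.Perm (Fin n))) hcard⟩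

/-- crux ⇒ L2 (the conclusion of L2 is the conclusion of the complex form of the crux). [folklore] -/
theorem crux_implies_orbitCompression (h : MonotoneRestorationQP) :
    ∀ f : (n : ℕ) → MvPolynomial (Fin n × Fin n) ℂ,
      (∀ (n : ℕ) (σ τ : Equiv.Perm (Fin n)),
        MvPolynomial.rename (fun p : Fin n × Fin n => (σ p.1, τ p.2)) (f n) = f n) →
      IsVPFamily f →
      (∃ c : ℕ, ∀ n : ℕ, ∃ (G : Type) (_ : Fintype G)
        (C : LabelledArithCircuit ℂ (Fin n × Fin n) Unit G),
        C.IsSymmetric (Equiv.Perm (Fin n)) ∧ C.eval (C.output ()) = f n ∧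
          C.orbitSize (Equiv.Perm (Fin n)) ≤ 2 ^ ((Nat.log 2 n + c) ^ c)) →
      ∃ c : ℕ, ∀ n : ℕ, ∃ (G : Type) (_ : Fintype G)
        (C : LabelledArithCircuit ℂ (Fin n × Fin n) Unit G),
        C.IsSymmetric (Equiv.Perm (Fin n)) ∧ C.eval (C.output ()) = f n ∧
          Fintype.card G ≤ 2 ^ ((Nat.log 2 n + c) ^ c) :=
  fun f hs hVP _ => monotoneRestorationQP_iff_complexRestorationQP.mp h f hs hVP

/-- The complex permanent is matrix-symmetric. [folklore] -/
theorem rename_perm_perPoly_complex (n : ℕ) (σ τ : Equiv.Perm (Fin n)) :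
    MvPolynomial.rename (fun p : Fin n × Fin n => (σ p.1, τ p.2)) (perPoly (Fin n) ℂ) =
      perPoly (Fin n) ℂ := by
  have h := congrArg (MvPolynomial.map (Complex.ofRealHom.comp NNReal.toRealHom))
    (MonotoneRestorationQP.Negative.rename_perm_perPoly n σ τ)
  rw [MvPolynomial.map_rename, map_perPoly] at h
  exact h

/-- **L1 ALONE DECIDES THE SUMMIT.** Orbit-form restoration implies `VP ℂ ≠ VNP ℂ`: under
`VP = VNP` the permanent is a matrix-symmetric `VP` family, so L1 gives it square-symmetric circuits
with orbits `≤ 2^((log₂ n + c)^c)`, while Dawar–Wilsenach Thm 7.1 in its ORBIT form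
(`DawarWilsenach2025_thm71_holds`, proved in the tree) gives orbits `≥ 2^(ε n)` infinitely often.
(Strategist gen 1, `Lines/orbit_compression.lean`; recorded for the route level: L2 is not needed for
the summit.) [cite: DawarWilsenach2025, Thm. 7.1 (p. 18)] -/
theorem orbitRestoration_decides
    (h₁ : ∀ f : (n : ℕ) → MvPolynomial (Fin n × Fin n) ℂ,
      (∀ (n : ℕ) (σ τ : Equiv.Perm (Fin n)),
        MvPolynomial.rename (fun p : Fin n × Fin n => (σ p.1, τ p.2)) (f n) = f n) →
      IsVPFamily f →
      ∃ c : ℕ, ∀ n : ℕ, ∃ (G : Type) (_ : Fintype G)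
        (C : LabelledArithCircuit ℂ (Fin n × Fin n) Unit G),
        C.IsSymmetric (Equiv.Perm (Fin n)) ∧ C.eval (C.output ()) = f n ∧
          C.orbitSize (Equiv.Perm (Fin n)) ≤ 2 ^ ((Nat.log 2 n + c) ^ c)) :
    _root_.ValiantsHypothesis := by
  classical
  show VP ℂ ≠ VNP ℂ
  intro hEq
  have hVP : IsVPFamily (fun n => perPoly (Fin n) ℂ) := by
    have hper : perFamily ℂ ∈ VP ℂ := by
      rw [hEq]; exact perFamily_mem_VNP_holds ℂ
    exact (mem_VP_ofFintype_iff_holds _).1 hper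
  obtain ⟨c, hc⟩ := h₁ (fun n => perPoly (Fin n) ℂ) rename_perm_perPoly_complex hVP
  choose G inst C hCsymm hCeval hCorb using hc
  obtain ⟨ε, hε, hfreq⟩ := @DawarWilsenach2025_thm71_holds ℂ _ _ G inst C hCsymm hCeval
  obtain ⟨n₀, key⟩ := MonotoneRestorationQP.Negative.polylog_pow_lt_linear c hε
  obtain ⟨n, hle, hn⟩ := (hfreq.and_eventually (eventually_ge_atTop n₀)).exists
  have horb : (((C n).orbitSize (Equiv.Perm (Fin n)) : ℕ) : ℝ) ≤
      (2 : ℝ) ^ (((Nat.log 2 n + c) ^ c : ℕ) : ℝ) := by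
    rw [Real.rpow_natCast]
    exact_mod_cast hCorb n
  have hlt : (2 : ℝ) ^ (((Nat.log 2 n + c) ^ c : ℕ) : ℝ) < (2 : ℝ) ^ (ε * n) := by
    apply (Real.rpow_lt_rpow_left_iff one_lt_two).2
    have := key n hn
    push_cast at this ⊢
    exact this
  exact absurd (hle.trans horb) (not_le.mpr hlt)

/-! ### Side stubs Z1–Z7 (lead c5): THEOREM ζ — the size calculus of square-symmetric circuits

Conventions as in the landed pairing stub E2 (`stub_symmetricPairing`, p155521): universe-0 types,
an arbitrary group `Γ` acting on the variables `X` and on the output index sets, `[MulAction Γ Unit]`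
taken as a parameter (any action on `Unit`), sizes as `Fintype.card` of the gate type. Each stub is
the universe-0 instance of a construction to be filed under
`Literature/Computability/AlgebraicComplexity/` next to `SymmetricCircuitPairing.lean`. -/

-- Z1 stub_symmetric_substitution: LANDED p161696 (…QPSymmetricSubstitution.lean; Literature SymmetricCircuitSubstitution.lean p161502).

-- Z2 stub_symmetric_scaledInputs: LANDED p161697 (…QPSymmetricScaledInputs.lean; Literature SymmetricCircuitScaledInputs.lean p161489).

-- Z3 stub_symmetric_foldOutputs: LANDED p161896 (…QPSymmetricFoldOutputs.lean; Literature SymmetricCircuitFold.lean p161679).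

-- Z4 stub_symmetric_hadamardOutputs: LANDED p161909 (…QPSymmetricHadamardOutputs.lean; Literature SymmetricCircuitHadamard.lean p161660).

-- Z5 stub_symmetric_linCombOutputs: LANDED p161889 (…QPSymmetricLinCombOutputs.lean; Literature SymmetricCircuitLinCombOutputs{,Symmetry}.lean p161514, p161693).

-- Z6 stub_homogeneousComponent_vandermonde: LANDED p161573 (…QPHomogeneousComponentVandermonde.lean).

-- Z7 stub_symmetric_forwardGradient: LANDED p162683 (…QPSymmetricForwardGradient.lean; Literature SymmetricCircuitGradient{,Symmetry}.lean p162029, p162405).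


/-! ### Side stubs Z8–Z11 (lead c5, wave 2): labelled families and a load-bearing certificate for L2

Z8–Z10 complete the calculus on EQUIVARIANT OUTPUT FAMILIES (families indexed by any finite
`Γ`-set `Y`, e.g. `Y = Fin k → Fin n`: `k`-labelled quantities), which is what the graph-algebra /
bounded-treewidth homomorphism engine (DPS25 §5) needs: invariant constant families (Z8), pull-back
(copy) along an equivariant map of index sets (Z9), and sums/products over the fibres of an
equivariant surjection (Z10: "forgetting a label"). Z11 certifies that the `VP` hypothesis of L2
cannot simply be dropped (degree witness, in the style of `Negative/UniformExponentFalse.lean`). -/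

-- Z8 stub_symmetric_constOutputs: LANDED p162884 (…QPSymmetricConstOutputs.lean; Literature SymmetricCircuitConstOutputs.lean p162696).

-- Z9 stub_symmetric_pullbackOutputs: LANDED p162814 (…QPSymmetricPullbackOutputs.lean; Literature SymmetricCircuitPullback.lean p162667).

-- Z10 stub_symmetric_fibreFold: LANDED p163030 (…QPSymmetricFibreFold.lean; Literature SymmetricCircuitFibreFold.lean p162772).

-- Z11 orbitCompression_false_without_VP: LANDED p163656 (Theorems/MonotoneRestorationQP/Negative/OrbitCompressionFalseWithoutVP.lean; Literature SymmetricPowerChainCircuit{,Rigid}.lean p163072, p163245): the VP hypothesis of L2 is load-bearing (degree witness).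


/-! ### Side stubs Z12–Z13 (lead c5, wave 3): the bridge to `complexity` and the adjugate

Z12 links the tree's straight-line programs (`ArithCircuit`, Bürgisser Def. 2.1: the currency of
`complexity`, `IsVPFamily`) to Dawar–Wilsenach labelled circuits: every program becomes a labelled
circuit of linear size over the SAME variables viewed with the trivial action (`TrivAct`, landed
p162806), hence symmetric for every group. With Z1 this gives THEOREM ζ-G: an ordinary program of
size `s` applied to INVARIANT generators that have symmetric circuits is a symmetric circuit
(census S10's `S⁺⁺ ⟹ crux`, unconditionally and for arbitrary generator families). Z13 is the
cofactor expansion `∂ det / ∂ x_ij = adj_ji` for the generic matrix; with Z7 (gradient of the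
Le Verrier circuit) and Z1 it gives THEOREM ζ-A: adjugates / inverses of equivariant matrix
circuits restore. -/

-- Z12 stub_labelled_of_arithCircuit: LANDED p164798 (…QPLabelledOfArithCircuit.lean; Literature ArithCircuitLabelled{,Eval}.lean p164401, p164589).

-- Z13 stub_pderiv_detPoly: LANDED p163852 (…QPPderivDetPoly.lean, via VonZurGathen.derivation_det).


/-! ### Side stubs N1–N4 (lead c5, cycle 2): a symmetric-SIZE lower bound that is not an orbit bound

DIMENSION COUNTING over `ℚ`. Every coefficient of every gate value of a circuit over `ℂ` lies in the
`ℚ`-subalgebra generated by the circuit's constants (N1); an algebraically independent family inside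
a subalgebra generated by `r` elements has at most `r` members (N2, transcendence degree); the
coordinates of a polynomial in a `ℚ`-defined linearly independent family are `ℚ`-linear functions
of its coefficients (N3); `ℂ` contains arbitrarily large algebraically independent families (N4).
Consequence (assembled by the lead, `Negative/DimensionCounting.lean`): a `ℚ`-GENERIC linear
combination of the `2^{n²}` products of elementary symmetric polynomials of the entries — a
matrix-symmetric family of polynomial degree inside the algebra of symmetric-cheap invariant
generators — needs `≥ 2^{n²}` gates in ANY circuit: the sharp form of "the `VP` hypothesis of L2 is
load-bearing" and the tree's first size lower bound for symmetric-cheap spans beyond orbit/degree. -/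

-- N1 stub_coeff_mem_adjoin_constants: LANDED p166714 (…QPCoeffMemAdjoinConstants.lean).

-- N2 stub_card_le_of_algebraicIndependent_adjoin: LANDED p166682 (…QPCardLeOfAlgebraicIndependentAdjoin.lean).

-- N3 stub_coords_mem_of_coeffs_mem: LANDED p166759 (…QPCoordsMemOfCoeffsMem.lean).

-- N4 stub_exists_algebraicIndependent_complex: LANDED p166719 (…QPExistsAlgebraicIndependentComplex.lean).
-- ASSEMBLY Negative/DimensionCounting.lean (p167153): esymmProd_linearIndependent, card_ge_of_generic (2^N ≤ |G|),
--   symmetricCheapSpan_not_qpSize (registered): the tree's first symmetric-SIZE lower bound beyond orbit/degree bounds.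

/-! ### Consequences of ζ composed by the lead (ALL LANDED)
* THEOREM ζ-H `…QPZetaHomogeneous.lean` (p161978): `zeta_symmetric_scale/scaledSum/homogeneousComponent`
  (`(d+2)(|G|+2|X|+9)` gates), `zeta_poly_mul_qp_le`, `qpSymmetric_homogeneousComponent` (registered).
* THEOREM ζ-M `…QPZetaMatrix.lean` (p162119): `zeta_symmetric_reindex/transpose/diagonal/matMul/trace/det`,
  `qpSymmetric_det` (registered).
* THEOREM ζ-A `…QPZetaAdjugate.lean` (p164362): `zeta_symmetric_adjugate_generic/adjugate` (Z7 ∘ Le Verrier, Z13, Z1),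
  `qpSymmetric_adjugate` (registered).
* THEOREM ζ-P `…QPZetaPatterns.lean` (p164593): `zeta_symmetric_patternExpr/_close` (labelled pattern expressions =
  the bipartite graph algebra, Literature `PatternExpressions.lean` p164274 with `homPoly`), `qpSymmetric_patternExpr` (registered).
* THEOREM ζ-G `…QPZetaGenerators.lean` (p165179): `zeta_isSymmetric_of_trivial`, `zeta_symmetric_family`,
  `zeta_symmetric_of_invariantGenerators{,_complexity}` (programs on invariant generators; `TrivAct` p162806, Z12),
  `qpSymmetric_of_invariantGenerators` (registered).
* THEOREM ζ-C `…QPZetaCharpoly.lean` (p165273): `zeta_symmetric_retarget`, `zeta_symmetric_charpolyCoeff{_generic,}`,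
  `zeta_symmetric_neg_family`, `qpSymmetric_charpolyCoeff` (registered).
* THEOREM ζ-E `…QPZetaEntrySymmetric.lean` (p166179): `zeta_symmetric_prod_one_add`, `zeta_symmetric_esymm`
  (e_k of the entries, `(|X|+2)(9|X|+15)` gates), `qpSymmetric_of_entrySymmetric` (registered; CONDITIONAL on the named
  fact `BlaserJindal2019_thm4`, Literature `BlaserJindalSymmetric.lean` p165678): the reflection-group regime restores.
* Negative: `Negative/OrbitCompressionFalseWithoutVP.lean` (p163656): L2 minus `IsVPFamily` is FALSE (degree);
  `Negative/OrbitRestorationFalseWithoutVP.lean` (p166257): L1 minus `IsVPFamily` is FALSE (per, DW71 orbit form). -/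

end Summit.ValiantsHypothesis.ValiantsHypothesis.Theorems
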